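import Literature.MathematicalPhysics.QuantumLattice.HubbardOpenBoxEDCertificate
import Literature.MathematicalPhysics.QuantumLattice.HubbardOpenBoxWitnessPlanes
import Literature.MathematicalPhysics.QuantumLattice.HubbardWave0LiebProofs
import HarnessLib

/-!
# Kernel-checked exact-diagonalisation certificates, upper side: witness planes of the open `a × b`
# `t–t'` Hubbard cluster from an explicit integer cluster vector

Topic `MathematicalPhysics/QuantumLattice`, family `hubbard`. Companion of `HubbardOpenBoxEDCertificate`
(floors). The tree's cluster variational principle `energyDensityTT'_le_of_openBox_witness_planes`
(`HubbardOpenBoxWitnessPlanes`; Ruelle 1969 §3.3) turns ONE unit `N`-particle cluster vector `φ` with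
bounds on its three quadratic forms (nearest-neighbour hopping, diagonal hopping, double occupancy) into
a PLANE of upper bounds `e(1, t', U, N/(ab)) ≤ (E_K + max(t' E_P, −t' E_M) + U E_D)/(ab)` for all `t'` and
all `U ≥ 0`. Here the four hypotheses are made EXECUTABLE BY THE KERNEL for an integer vector given as a
packed table over the occupation codes (Lin–Gubernatis basis, `HubbardOpenBoxOccupationCode`):

* §1 the coded APPLICATION of a hopping word, `hopApply p q m f` (`= ((c†_p c_q) φ)(s)` for
  `φ s = f (code s)`, `creation_mul_annihilation_mulVec_code`), of the coded cluster Hamiltonian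
  (`hubbardOpenBoxTT'_mulVec_code`), and the reindexing of Fock-space sums by codes (`sum_univ_code`);
* §2 the certificate `UpperCert` (chunked packed table), the integer quadratic forms `SK, SD, DD, NN`,
  the Boolean `UpperCert.check a b N EK EP EM ED` (structural loops; `decide +kernel`) and
  **`UpperCert.sound`**: `check = true ⇒ ∀ t', ∀ U ≥ 0, e(1,t',U,N/(ab)) ≤ (EK + max (t' EP) (−t' EM) + U ED)/(ab)`.

Everything is proved; no named fact; nothing numerical is asserted here.

## References

* D. Ruelle, *Statistical Mechanics: Rigorous Results* (1969), §3.3. [cite: Ruelle1969, §3.3]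
* H. Q. Lin, J. E. Gubernatis, Comput. Phys. 7 (1993) 400, §II. [cite: LinGubernatis1993, §II]
* H. Tasaki, *Physics and Mathematics of Quantum Many-Body Systems* (2020), §9.3.1 (hopping words on
  occupation states). [cite: Tasaki2020, §9.3.1]
-/

namespace Literature.MathematicalPhysics.QuantumLattice

namespace OccupationCode

open Finset Matrix

/-! ### §1 Coded application of hopping words and of the cluster Hamiltonian -/

/-- **Coded application of the hopping word `c†_p c_q`** to `φ = f ∘ code` at the code `m`: nonzero
iff bit `p` of `m` is set and bit `q` of `m − 2^p` is clear; then the value is the product of the two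
Jordan–Wigner parities times `f (m − 2^p + 2^q)`. [cite: LinGubernatis1993, §II] -/
def hopApply (p q m : ℕ) (f : ℕ → ℤ) : ℤ :=
  if m.testBit p = true ∧ (m - 2 ^ p).testBit q = false then
    (-1) ^ (bitCount (m - 2 ^ p) p + bitCount (m - 2 ^ p) q) * f (m - 2 ^ p + 2 ^ q) else 0

/-- Coded application of the hopping matrix of a coded adjacency: `Σ_{P ~ Q, σ} hopApply (2P+σ) (2Q+σ)`.
[cite: LinGubernatis1993, §II] -/
def openBoxHopApply (adj : ℕ → ℕ → Bool) (N m : ℕ) (f : ℕ → ℤ) : ℤ :=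
  sumNat (fun P => sumNat (fun Q => if adj P Q then
    sumNat (fun σ => hopApply (2 * P + σ) (2 * Q + σ) m f) 2 else 0) N) N

/-- The number of doubly occupied sites of a code (`doccCode m m`). [cite: LinGubernatis1993, §II] -/
def doccOf (N m : ℕ) : ℤ := sumNat (fun P => if m.testBit (2 * P) && m.testBit (2 * P + 1) then 1 else 0) N

section Box

variable {a b : ℕ}

/-- The Fock vector with integer coefficients read through the code: `φ_f s = f (code s)`.
[cite: LinGubernatis1993, §II] -/
def codedVec (f : ℕ → ℤ) : Fock (Orb (Fin a ×ₗ Fin b)) := fun s => (f (code s) : ℂ)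

/-- **Hopping word on a coded vector**: `((c†_i c_j) φ_f)(s) = hopApply (orbRank i) (orbRank j) (code s) f`.
[cite: Tasaki2020, §9.3.1] [cite: LinGubernatis1993, §II] -/
theorem creation_mul_annihilation_mulVec_code (i j : Orb (Fin a ×ₗ Fin b)) (f : ℕ → ℤ)
    (s : Finset (Orb (Fin a ×ₗ Fin b))) :
    ((creation i * annihilation j) *ᵥ codedVec f) s = (hopApply (orbRank i) (orbRank j) (code s) f : ℂ) := by
  rw [LiebThm1.creation_mul_annihilation_mulVec_apply, hopApply]
  by_cases hi : i ∈ s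
  · have hp : (code s).testBit (orbRank i) = true := (mem_iff_testBit_code s i).1 hi
    have hu : code (s.erase i) = code s - 2 ^ orbRank i := code_erase hi
    by_cases hj : j ∉ s.erase i
    · have hq : (code s - 2 ^ orbRank i).testBit (orbRank j) = false := by
        rw [← hu]; exact Bool.eq_false_iff.2 fun h => hj ((mem_iff_testBit_code _ j).2 h)
      have hins : code (insert j (s.erase i)) = code s - 2 ^ orbRank i + 2 ^ orbRank j := by
        rw [code_insert hj, hu]
      rw [if_pos ⟨hi, hj⟩, if_pos ⟨hp, hq⟩, jwSign_eq_neg_one_pow_bitCount, jwSign_eq_neg_one_pow_bitCount,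
        hu, codedVec, hins, ← pow_add]
      push_cast
      ring
    · have hq : ¬ (code s - 2 ^ orbRank i).testBit (orbRank j) = false := by
        rw [← hu, Bool.eq_false_iff, not_not]; exact (mem_iff_testBit_code _ j).1 (not_not.1 hj)
      rw [if_neg (fun h => hj h.2), if_neg (fun h => hq h.2)]
      simp
  · have hp : ¬ (code s).testBit (orbRank i) = true := fun h => hi ((mem_iff_testBit_code s i).2 h)
    rw [if_neg (fun h => hi h.1), if_neg (fun h => hp h.1)]
    simp

/-- Applying a finite sum of matrices. [folklore] -/
private theorem sum_mulVec_apply {ι κ : Type*} [Fintype κ] (S : Finset ι) (M : ι → Matrix κ κ ℂ) (v : κ → ℂ) (x : κ) :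
    ((∑ i ∈ S, M i) *ᵥ v) x = ∑ i ∈ S, (M i *ᵥ v) x := by
  simp only [mulVec, dotProduct, Matrix.sum_apply, Finset.sum_mul]
  rw [Finset.sum_comm]

/-- Entries of `H(t,U) φ` for a graph Hamiltonian: hopping words and the double occupancy.
[cite: Tasaki2020, §9.3.1] -/
theorem hamiltonian_mulVec_apply {Λ : Type*} [LinearOrder Λ] [Fintype Λ] (G : SimpleGraph Λ) [DecidableRel G.Adj]
    (t U : ℝ) (φ : Fock (Orb Λ)) (s : Finset (Orb Λ)) :
    (hamiltonian G t U *ᵥ φ) s =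
      -(t : ℂ) * (∑ x : Λ, ∑ y : Λ, ∑ σ : Fin 2,
          if G.Adj x y then ((creation (orb x σ) * annihilation (orb y σ)) *ᵥ φ) s else 0) +
        (U : ℂ) * (((doublyOccupied s).card : ℂ) * φ s) := by
  rw [hamiltonian, add_mulVec, smul_mulVec, smul_mulVec, Pi.add_apply, Pi.smul_apply, Pi.smul_apply,
    smul_eq_mul, smul_eq_mul, sum_numberOp_mul_numberOp_eq_diagonal, mulVec_diagonal]
  congr 2
  rw [sum_mulVec_apply]
  refine Finset.sum_congr rfl fun x _ => ?_
  rw [sum_mulVec_apply]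
  refine Finset.sum_congr rfl fun y _ => ?_
  rw [sum_mulVec_apply]
  refine Finset.sum_congr rfl fun σ _ => ?_
  split_ifs with h
  · rfl
  · simp

/-- The hopping part applied to a coded vector, in code form. [cite: LinGubernatis1993, §II] -/
theorem sum_hop_mulVec_code (G : SimpleGraph (Fin a ×ₗ Fin b)) [DecidableRel G.Adj] (adj : ℕ → ℕ → Bool)
    (hadj : ∀ x y, adj (siteRank x) (siteRank y) = true ↔ G.Adj x y) (f : ℕ → ℤ)
    (s : Finset (Orb (Fin a ×ₗ Fin b))) :
    (∑ x : Fin a ×ₗ Fin b, ∑ y : Fin a ×ₗ Fin b, ∑ σ : Fin 2,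
        if G.Adj x y then ((creation (orb x σ) * annihilation (orb y σ)) *ᵥ codedVec f) s else 0) =
      ((openBoxHopApply adj (a * b) (code s) f : ℤ) : ℂ) := by
  have hcast : ((openBoxHopApply adj (a * b) (code s) f : ℤ) : ℂ) =
      sumNat (fun P => sumNat (fun Q => if adj P Q then
        sumNat (fun σ => (hopApply (2 * P + σ) (2 * Q + σ) (code s) f : ℂ)) 2 else 0) (a * b)) (a * b) := by
    simp only [openBoxHopApply, sumNat_eq]
    push_cast
    rfl
  rw [hcast, ← sum_site_eq_sumNat]
  refine Finset.sum_congr rfl fun x _ => ?_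
  rw [← sum_site_eq_sumNat]
  refine Finset.sum_congr rfl fun y _ => ?_
  by_cases hxy : G.Adj x y
  · rw [if_pos ((hadj x y).2 hxy), Fin.sum_univ_two, if_pos hxy, if_pos hxy, sumNat, sumNat, sumNat,
      creation_mul_annihilation_mulVec_code, creation_mul_annihilation_mulVec_code,
      orbRank_orb, orbRank_orb, orbRank_orb, orbRank_orb]
    simp
  · have : adj (siteRank x) (siteRank y) = false := Bool.eq_false_iff.2 fun h => hxy ((hadj x y).1 h)
    rw [this]
    simp [hxy]

/-- The number of doubly occupied sites in code form. [cite: LinGubernatis1993, §II] -/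
theorem card_doublyOccupied_eq_doccOf (s : Finset (Orb (Fin a ×ₗ Fin b))) :
    ((doublyOccupied s).card : ℤ) = doccOf (a * b) (code s) := by
  have h := sum_docc_eq_doccCode s s
  rw [doccCode, if_pos rfl] at h
  have h2 : (∑ x : Fin a ×ₗ Fin b, (numberOp x 0 * numberOp x 1) s s) = ((doublyOccupied s).card : ℂ) := by
    rw [← Matrix.sum_apply, sum_numberOp_mul_numberOp_eq_diagonal, diagonal_apply_eq]
  rw [h2] at h
  rw [doccOf]
  exact_mod_cast h

/-- **The cluster Hamiltonian on a coded vector**, in code form: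
`(H^open(t,t',U) φ_f)(s) = −t·openBoxHopApply nn − t'·openBoxHopApply diag + U·docc·f` at `code s`.
[cite: LinGubernatis1993, §II] -/
theorem hubbardOpenBoxTT'_mulVec_code (a b : ℕ) (t t' U : ℝ) (f : ℕ → ℤ) (s : Finset (Orb (Fin a ×ₗ Fin b))) :
    (hubbardOpenBoxTT' a b t t' U *ᵥ codedVec f) s =
      ((-t * openBoxHopApply (nnAdjCode b) (a * b) (code s) f - t' * openBoxHopApply (diagAdjCode b) (a * b) (code s) f
        + U * (doccOf (a * b) (code s) * f (code s)) : ℝ) : ℂ) := by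
  rw [hubbardOpenBoxTT', add_mulVec, Pi.add_apply, hamiltonian_mulVec_apply, hamiltonian_mulVec_apply,
    sum_hop_mulVec_code _ (nnAdjCode b) nnAdjCode_siteRank, sum_hop_mulVec_code _ (diagAdjCode b) diagAdjCode_siteRank]
  have hd : ((doublyOccupied s).card : ℂ) = ((doccOf (a * b) (code s) : ℤ) : ℂ) := by
    exact_mod_cast card_doublyOccupied_eq_doccOf s
  rw [hd, codedVec]
  push_cast
  ring

/-- **Reindexing Fock-space sums by codes**: `Σ_s F (code s) = Σ_{m < 4^{ab}} F m` (structural form).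
[cite: LinGubernatis1993, §II] -/
theorem sum_univ_code {M : Type*} [AddCommMonoid M] (F : ℕ → M) :
    ∑ s : Finset (Orb (Fin a ×ₗ Fin b)), F (code s) = sumNat F (4 ^ (a * b)) := by
  rw [sumNat_eq]
  refine Finset.sum_nbij' code (fun m => decode m) (fun s _ => mem_range.2 (code_lt s)) ?_ (fun s _ => decode_code s)
    (fun m hm => code_decode (mem_range.1 hm)) (fun s _ => rfl)
  intro m hm
  exact mem_univ _

end Box

/-! ### §2 The upper certificate, its kernel checker and its soundness -/

/-- Field number `idx` (width `w`) of the packed natural `T`, read by a shift. [cite: LinGubernatis1993, §II] -/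
def fieldS (T w idx : ℕ) : ℕ := (T >>> (w * idx)) % 2 ^ w

/-- **An upper (variational) certificate for the open cluster**: an integer cluster vector stored as a
CHUNKED packed table over the occupation codes (`tab c` holds the codes with `m >>> cbits = c`, fields of
width `w`, offset `2^(w-1)`). [cite: LinGubernatis1993, §II] -/
structure UpperCert where
  /-- field width -/
  w : ℕ
  /-- number of low code bits addressing inside a chunk -/
  cbits : ℕ
  /-- the chunks -/
  tab : ℕ → ℕ

namespace UpperCert

variable (C : UpperCert)

/-- The integer coefficient of the code `m`. [cite: LinGubernatis1993, §II] -/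
def fAt (m : ℕ) : ℤ := (fieldS (C.tab (m >>> C.cbits)) C.w (m % 2 ^ C.cbits) : ℤ) - 2 ^ (C.w - 1)

/-- `Σ_m f(m)·(hopping matrix of `adj` applied to f)(m)` (so that `⟨φ, H(1,0,0) φ⟩ = −SHop nn`,
`⟨φ, H(0,1,0) φ⟩ = −SHop diag`). [cite: LinGubernatis1993, §II] -/
def SHop (adj : ℕ → ℕ → Bool) (a b : ℕ) : ℤ :=
  sumNat (fun m => if C.fAt m = 0 then 0 else C.fAt m * openBoxHopApply adj (a * b) m C.fAt) (4 ^ (a * b))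

/-- `Σ_m docc(m) f(m)² = ⟨φ, H(0,0,1) φ⟩`. [cite: LinGubernatis1993, §II] -/
def SD (a b : ℕ) : ℤ := sumNat (fun m => if C.fAt m = 0 then 0 else doccOf (a * b) m * (C.fAt m * C.fAt m)) (4 ^ (a * b))

/-- `Σ_m f(m)² = ‖φ‖²`. [cite: LinGubernatis1993, §II] -/
def NN (a b : ℕ) : ℤ := sumNat (fun m => C.fAt m * C.fAt m) (4 ^ (a * b))

/-- **THE KERNEL CHECKER**: `φ ≠ 0`, `φ` is supported on `N`-particle codes, and the four quadratic-form
bounds `−SHop nn ≤ EK·‖φ‖²`, `−SHop diag ≤ EP·‖φ‖²`, `SHop diag ≤ EM·‖φ‖²`, `SD ≤ ED·‖φ‖²`.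
[cite: Ruelle1969, §3.3] -/
def check (a b N : ℕ) (EK EP EM ED : ℚ) : Bool :=
  decide (0 < C.NN a b) &&
    allNat (fun m => decide (upCount (a * b) m + dnCount (a * b) m = N) || decide (C.fAt m = 0)) (4 ^ (a * b)) &&
    decide ((-(C.SHop (nnAdjCode b) a b) : ℚ) ≤ EK * C.NN a b) &&
    decide ((-(C.SHop (diagAdjCode b) a b) : ℚ) ≤ EP * C.NN a b) &&
    decide (((C.SHop (diagAdjCode b) a b) : ℚ) ≤ EM * C.NN a b) &&
    decide (((C.SD a b) : ℚ) ≤ ED * C.NN a b)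

section Sound

variable {a b N : ℕ} {EK EP EM ED : ℚ}

/-- `⟨φ_f, H^open(t,t',U) φ_f⟩ = −t·SHop nn − t'·SHop diag + U·SD`. [cite: LinGubernatis1993, §II] -/
theorem star_dotProduct_mulVec_codedVec (a b : ℕ) (t t' U : ℝ) :
    star (codedVec (a := a) (b := b) C.fAt) ⬝ᵥ (hubbardOpenBoxTT' a b t t' U *ᵥ codedVec C.fAt) =
      ((-t * C.SHop (nnAdjCode b) a b - t' * C.SHop (diagAdjCode b) a b + U * C.SD a b : ℝ) : ℂ) := by
  rw [dotProduct]
  have hterm : ∀ s : Finset (Orb (Fin a ×ₗ Fin b)),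
      (star (codedVec (a := a) (b := b) C.fAt)) s * (hubbardOpenBoxTT' a b t t' U *ᵥ codedVec C.fAt) s =
        (((fun m : ℕ => -t * ((if C.fAt m = 0 then 0 else C.fAt m * openBoxHopApply (nnAdjCode b) (a * b) m C.fAt : ℤ) : ℝ)
            - t' * ((if C.fAt m = 0 then 0 else C.fAt m * openBoxHopApply (diagAdjCode b) (a * b) m C.fAt : ℤ) : ℝ)
            + U * ((if C.fAt m = 0 then 0 else doccOf (a * b) m * (C.fAt m * C.fAt m) : ℤ) : ℝ)) (code s) : ℝ) : ℂ) := by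
    intro s
    rw [hubbardOpenBoxTT'_mulVec_code]
    simp only [codedVec, Pi.star_apply, RCLike.star_def, map_intCast]
    by_cases h0 : C.fAt (code s) = 0
    · simp [h0]
    · simp only [h0, if_false]
      push_cast
      ring
  simp_rw [hterm]
  rw [sum_univ_code (fun m => (((-t * ((if C.fAt m = 0 then 0 else C.fAt m * openBoxHopApply (nnAdjCode b) (a * b) m C.fAt : ℤ) : ℝ)
            - t' * ((if C.fAt m = 0 then 0 else C.fAt m * openBoxHopApply (diagAdjCode b) (a * b) m C.fAt : ℤ) : ℝ)
            + U * ((if C.fAt m = 0 then 0 else doccOf (a * b) m * (C.fAt m * C.fAt m) : ℤ) : ℝ)) : ℝ) : ℂ))]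
  rw [SHop, SHop, SD, sumNat_eq, sumNat_eq, sumNat_eq, sumNat_eq]
  push_cast
  simp only [Finset.mul_sum, ← Finset.sum_sub_distrib, ← Finset.sum_add_distrib]

/-- `⟨φ_f, φ_f⟩ = NN`. [cite: LinGubernatis1993, §II] -/
theorem star_dotProduct_codedVec (a b : ℕ) :
    star (codedVec (a := a) (b := b) C.fAt) ⬝ᵥ codedVec C.fAt = ((C.NN a b : ℝ) : ℂ) := by
  rw [dotProduct]
  have hterm : ∀ s : Finset (Orb (Fin a ×ₗ Fin b)), (star (codedVec (a := a) (b := b) C.fAt)) s * codedVec C.fAt s =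
      (((fun m : ℕ => ((C.fAt m * C.fAt m : ℤ) : ℝ)) (code s) : ℝ) : ℂ) := by
    intro s
    simp only [codedVec, Pi.star_apply, RCLike.star_def, map_intCast]
    push_cast
    ring
  simp_rw [hterm]
  rw [sum_univ_code (fun m => ((((C.fAt m * C.fAt m : ℤ) : ℝ) : ℝ) : ℂ)), NN, sumNat_eq, sumNat_eq]
  push_cast
  rfl

/-- A coded vector supported on `N`-particle codes is an `N`-particle vector. [cite: LinGubernatis1993, §II] -/
theorem isNParticle_codedVec (f : ℕ → ℤ)
    (hf : ∀ m < 4 ^ (a * b), upCount (a * b) m + dnCount (a * b) m = N ∨ f m = 0) :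
    IsNParticle N (codedVec (a := a) (b := b) f) := by
  intro s hs
  rcases hf (code s) (code_lt s) with h | h
  · exfalso
    apply hs
    rw [card_eq_upPart_add_downPart, card_upPart_eq_upCount, card_downPart_eq_dnCount, h]
  · simp [codedVec, h]

/-- **SOUNDNESS of the upper checker.** If `C.check a b N EK EP EM ED = true` (`N < 2ab`, `a, b ≥ 1`),
then for every `t'` and every `U ≥ 0`:
`e(1, t', U, N/(ab)) ≤ (EK + max (t'·EP) (−t'·EM) + U·ED)/(ab)` — the witness plane of the normalised
cluster vector. [cite: Ruelle1969, §3.3] -/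
theorem sound (h : C.check a b N EK EP EM ED = true) (ha : 1 ≤ a) (hb : 1 ≤ b) (hN : N < 2 * (a * b))
    (t' : ℝ) {U : ℝ} (hU : 0 ≤ U) :
    ThermodynamicLimit.energyDensityTT' 1 t' U ((N : ℝ) / ((a : ℝ) * (b : ℝ))) ≤
      ((EK : ℝ) + max (t' * EP) (-t' * EM) + U * ED) / ((a : ℝ) * (b : ℝ)) := by
  simp only [check, Bool.and_eq_true, decide_eq_true_eq] at h
  obtain ⟨⟨⟨⟨⟨hNN, hsupp⟩, hK⟩, hP⟩, hM⟩, hD⟩ := h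
  -- the normalised vector
  set φ : Fock (Orb (Fin a ×ₗ Fin b)) := codedVec C.fAt with hφ
  have hnorm : star φ ⬝ᵥ φ = ((C.NN a b : ℝ) : ℂ) := C.star_dotProduct_codedVec a b
  set c : ℝ := Real.sqrt (C.NN a b : ℝ)⁻¹ with hc
  have hNNpos : (0 : ℝ) < (C.NN a b : ℝ) := by exact_mod_cast hNN
  have hc2 : c ^ 2 = ((C.NN a b : ℝ))⁻¹ := by
    rw [hc, Real.sq_sqrt (inv_nonneg.2 hNNpos.le)]
  let ψ : Fock (Orb (Fin a ×ₗ Fin b)) := (c : ℂ) • φ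
  have hψφ : ∀ A : Matrix (Finset (Orb (Fin a ×ₗ Fin b))) (Finset (Orb (Fin a ×ₗ Fin b))) ℂ,
      star ψ ⬝ᵥ (A *ᵥ ψ) = ((c ^ 2 : ℝ) : ℂ) * (star φ ⬝ᵥ (A *ᵥ φ)) := by
    intro A
    simp only [ψ, star_smul, mulVec_smul, smul_dotProduct, dotProduct_smul, smul_eq_mul, RCLike.star_def,
      Complex.conj_ofReal]
    push_cast
    ring
  have hψ1 : star ψ ⬝ᵥ ψ = 1 := by
    have : star ψ ⬝ᵥ ψ = ((c ^ 2 : ℝ) : ℂ) * (star φ ⬝ᵥ φ) := by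
      simp only [ψ, star_smul, smul_dotProduct, dotProduct_smul, smul_eq_mul, RCLike.star_def, Complex.conj_ofReal]
      push_cast
      ring
    rw [this, hnorm, hc2, ← Complex.ofReal_mul, inv_mul_cancel₀ hNNpos.ne']
    simp
  have hψN : IsNParticle N ψ := by
    have hφN : IsNParticle N φ := isNParticle_codedVec C.fAt fun m hm => by
      have := of_allNat hsupp m hm
      rw [Bool.or_eq_true, decide_eq_true_eq, decide_eq_true_eq] at this
      exact this
    intro s hs
    simp [ψ, hφN s hs]
  -- the four quadratic forms of ψ
  have form : ∀ (t₀ s₀ u₀ : ℝ), (star ψ ⬝ᵥ (hubbardOpenBoxTT' a b t₀ s₀ u₀ *ᵥ ψ)).re =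
      c ^ 2 * (-t₀ * C.SHop (nnAdjCode b) a b - s₀ * C.SHop (diagAdjCode b) a b + u₀ * C.SD a b) := by
    intro t₀ s₀ u₀
    rw [hψφ, C.star_dotProduct_mulVec_codedVec, ← Complex.ofReal_mul, Complex.ofReal_re]
  -- `X ≤ E · NN ⇒ c² X ≤ E`
  have key : ∀ {X E : ℝ}, X ≤ E * (C.NN a b : ℝ) → c ^ 2 * X ≤ E := by
    intro X E h1
    rw [hc2, inv_mul_le_iff₀ hNNpos]
    linarith [h1, mul_comm E (C.NN a b : ℝ)]
  have hKr : (star ψ ⬝ᵥ (hubbardOpenBoxTT' a b 1 0 0 *ᵥ ψ)).re ≤ EK := by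
    rw [form]
    have h1 : (-(C.SHop (nnAdjCode b) a b : ℝ)) ≤ (EK : ℝ) * (C.NN a b : ℝ) := by exact_mod_cast hK
    have h2 := key h1
    refine le_trans (le_of_eq ?_) h2
    ring
  have hPr : (star ψ ⬝ᵥ (hubbardOpenBoxTT' a b 0 1 0 *ᵥ ψ)).re ≤ EP := by
    rw [form]
    have h1 : (-(C.SHop (diagAdjCode b) a b : ℝ)) ≤ (EP : ℝ) * (C.NN a b : ℝ) := by exact_mod_cast hP
    have h2 := key h1
    refine le_trans (le_of_eq ?_) h2
    ring
  have hMr : (star ψ ⬝ᵥ (hubbardOpenBoxTT' a b 0 (-1) 0 *ᵥ ψ)).re ≤ EM := by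
    rw [form]
    have h1 : ((C.SHop (diagAdjCode b) a b : ℝ)) ≤ (EM : ℝ) * (C.NN a b : ℝ) := by exact_mod_cast hM
    have h2 := key h1
    refine le_trans (le_of_eq ?_) h2
    ring
  have hDr : (star ψ ⬝ᵥ (hubbardOpenBoxTT' a b 0 0 1 *ᵥ ψ)).re ≤ ED := by
    rw [form]
    have h1 : ((C.SD a b : ℝ)) ≤ (ED : ℝ) * (C.NN a b : ℝ) := by exact_mod_cast hD
    have h2 := key h1
    refine le_trans (le_of_eq ?_) h2
    ring
  have hw := ThermodynamicLimit.energyDensityTT'_le_of_openBox_witness_planes (a := a) (b := b) hU ha hb hN hψN hψ1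
    hKr hPr hMr hDr t'
  simpa using hw

end Sound

end UpperCert

end OccupationCode

end Literature.MathematicalPhysics.QuantumLattice
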